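import Summits.ValiantsHypothesis.ValiantsHypothesis.Theorems.GrenetZeonDualUnipotentThreeHalvesHeavyTopThmCBandCalculus
import Summits.ValiantsHypothesis.ValiantsHypothesis.Theorems.GrenetZeonDualUnipotentThreeHalvesHeavyTopThmCnStructure
import Summits.ValiantsHypothesis.ValiantsHypothesis.Theorems.GrenetZeonDualUnipotentThreeHalvesHeavyTopThmCStructure

/-!
# `GrenetZeon.DualUnipotentThreeHalves` (stmt-ValiantsHypothesis-24318), R2 heavy-top instrument — UNIFORM THEOREM C, FILE 3:
# the coefficient identities (T1) window vector, (T2) mixed word, (T3) squares, uniform in `n` and `s`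

Experiment cell «val-heavytop-census» (D-0160), engine seat val-htc-eng-1 g5.  The identities of val-idea-30 MEMO codim-one §1 for a graded nilpotent space
`W ≤ M_n(ℂ)` containing the shift `J`, in the band notation of ✓ `…ThmCBandCalculus` (`U_h(x)`, `L_h(c)`; `P_h = W.map (dp h)`, `N_h = W.map (dm h)` as in
✓ `…ThmCnGradedCount`), replacing the generated per-`n` files `…ThmC*Window*` of the `n ≤ 7` ports:

* `upper_band_mem` — `p ∈ P_h ⇒ U_h(p) ∈ W` (graded; companion of ✓ `lower_band_mem`);
* (T3) `sum_mul_sq_eq_zero` — `U_{2s}(x), L_s(c) ∈ W ⇒ Σ_a x_a c_a c_{a+s} = 0`; `sq_eq_zero_of_unit_mem` — `E_{i,i+2s} ∈ W ⇒ c_i c_{i+s} = 0`;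
* (T1) `window_orth` — `J, L_s(c), U_1(p) ∈ W ⇒ Σ_k p_k C_k(c) = 0` with the WINDOW SUMS `C_k(c) = Σ_{k−s<i≤k} c_i`, and ★ `window_lower_mem` —
  under zero slack at height `1`, `L_1(C(c)) ∈ W`;
* (T2) `mixed_word` — `U_{s+1}(x), L_s(c), L_1(C) ∈ W ⇒ Σ_i x_i (c_{i+1} C_i + C_{i+s} c_i) = 0`.

Honest framing: infrastructure; nothing here proves or refutes `HeavyTopLaw`/`HeavyTopSlowLaw`, 24318, S3 or 8062; `VP ≠ VNP` is NOT proved.  No definitions.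
[val-idea-30 MEMO codim-one §1 (T1)–(T3); this seat]
-/

noncomputable section

-- single-conjunct layout: Sub = Summit, duplicated namespace component intended
set_option linter.dupNamespace false

namespace Summit.ValiantsHypothesis.ValiantsHypothesis.Theorems.GrenetZeon.HeavyTopThmCIdentities

open Matrix
open Summit.ValiantsHypothesis.ValiantsHypothesis.Theorems.GrenetZeon.HeavyTopThmCTraceKit
  (trace_mul_pow_eq_zero_of_mem trace_mixed_eq_zero_of_mem)
open Summit.ValiantsHypothesis.ValiantsHypothesis.Theorems.GrenetZeon.HeavyTopThmCBandCalculus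
open Summit.ValiantsHypothesis.ValiantsHypothesis.Theorems.GrenetZeon.HeavyTopThmCnGradedCount (shiftPow_apply sum_dite_eq_sum_fin)
open Summit.ValiantsHypothesis.ValiantsHypothesis.Theorems.GrenetZeon.HeavyTopThmCnStructure (lower_band_mem)
open Summit.ValiantsHypothesis.ValiantsHypothesis.Theorems.GrenetZeon.HeavyTopThmCStructure (mem_of_dot_eq_zero)

variable {n : ℕ}

/-! ## Reading an upper band off `P_h` -/

/-- `dp h A` read as an upper band: if `A ∈ W` and `p_i = (dp h A)_i` for `i < n − h`, then `U_h(p) = Σ_a p_a E_{a,a+h} ∈ W`. -/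
theorem upper_band_mem (W : Submodule ℂ (Matrix (Fin n) (Fin n) ℂ))
    (hgr : ∀ A ∈ W, ∀ d : ℤ, (Matrix.of fun a b : Fin n => if (b : ℤ) - (a : ℤ) = d then A a b else 0) ∈ W) (h : ℕ)
    (dp : Matrix (Fin n) (Fin n) ℂ →ₗ[ℂ] (Fin (n - h) → ℂ))
    (hdp : ∀ A (i : Fin (n - h)) (a b : Fin n), (a : ℕ) = i → (b : ℕ) = i + h → dp A i = A a b)
    (A : Matrix (Fin n) (Fin n) ℂ) (hA : A ∈ W) (p : Fin n → ℂ)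
    (hp : ∀ i : Fin (n - h), p ⟨(i : ℕ), by omega⟩ = dp A i) :
    (Matrix.of fun a b : Fin n => if (b : ℕ) = (a : ℕ) + h then p a else 0) ∈ W := by
  have key : (Matrix.of fun a b : Fin n => if (b : ℕ) = (a : ℕ) + h then p a else 0) =
      Matrix.of fun a b : Fin n => if (b : ℤ) - (a : ℤ) = (h : ℤ) then A a b else 0 := by
    ext a b
    simp only [Matrix.of_apply]
    by_cases hab : (b : ℕ) = (a : ℕ) + h
    · rw [if_pos hab, if_pos (by omega)]
      have e := hp ⟨(a : ℕ), by omega⟩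
      rw [hdp A _ a b rfl (by simpa using hab)] at e
      simpa using e
    · rw [if_neg hab, if_neg (by omega)]
  rw [key]; exact hgr A hA h

/-! ## (T3) squares -/

/-- **(T3)** `U_{2s}(x), L_s(c)` in a nilpotent space ⇒ `Σ_a x_a c_{a+s} c_a [a+2s<n] = 0` (`tr(U · L²) = 0`). [memo §1 (T3); this seat] -/
theorem sum_mul_sq_eq_zero (W : Submodule ℂ (Matrix (Fin n) (Fin n) ℂ)) (hW : ∀ A ∈ W, IsNilpotent A) (s : ℕ) (x c : Fin n → ℂ)
    (hX : (Matrix.of fun a b : Fin n => if (b : ℕ) = (a : ℕ) + 2 * s then x a else 0) ∈ W)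
    (hY : (Matrix.of fun a b : Fin n => if (a : ℕ) = (b : ℕ) + s then c b else 0) ∈ W) :
    ∑ a : Fin n, (if ha : (a : ℕ) + 2 * s < n then x a * (c ⟨(a : ℕ) + s, by omega⟩ * c a) else 0) = 0 := by
  have h := trace_mul_pow_eq_zero_of_mem W hW hY hX 2
  rw [pow_two, lowerBand_mul_lowerBand, show s + s = 2 * s by ring, trace_upperBand_mul_lowerBand] at h
  have e : (∑ a : Fin n, (if ha : (a : ℕ) + 2 * s < n then x a * (c ⟨(a : ℕ) + s, by omega⟩ * c a) else 0)) =
      ∑ a : Fin n, (if (a : ℕ) + 2 * s < n then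
        x a * (if hb : (a : ℕ) + s < n then c ⟨(a : ℕ) + s, hb⟩ * c a else 0) else 0) := by
    refine Finset.sum_congr rfl fun a _ => ?_
    by_cases ha : (a : ℕ) + 2 * s < n
    · rw [dif_pos ha, if_pos ha, dif_pos (by omega)]
    · rw [dif_neg ha, if_neg ha]
  rw [e]; exact h

/-- **(T3), unit form**: `E_{i,i+2s}, L_s(c)` in a nilpotent space ⇒ `c_{i+s} c_i = 0`. [memo §1 (T3); this seat] -/
theorem sq_eq_zero_of_unit_mem (W : Submodule ℂ (Matrix (Fin n) (Fin n) ℂ)) (hW : ∀ A ∈ W, IsNilpotent A) (s : ℕ) (c : Fin n → ℂ)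
    (i : ℕ) (hi : i + 2 * s < n)
    (hE : (Matrix.of fun a b : Fin n => if (a : ℕ) = i ∧ (b : ℕ) = i + 2 * s then (1 : ℂ) else 0) ∈ W)
    (hY : (Matrix.of fun a b : Fin n => if (a : ℕ) = (b : ℕ) + s then c b else 0) ∈ W) :
    c ⟨i + s, by omega⟩ * c ⟨i, by omega⟩ = 0 := by
  have e : (Matrix.of fun a b : Fin n => if (a : ℕ) = i ∧ (b : ℕ) = i + 2 * s then (1 : ℂ) else 0) =
      Matrix.of fun a b : Fin n => if (b : ℕ) = (a : ℕ) + 2 * s then (fun a : Fin n => if (a : ℕ) = i then (1 : ℂ) else 0) a else 0 := by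
    ext a b; simp only [Matrix.of_apply]
    by_cases ha : (a : ℕ) = i
    · by_cases hb : (b : ℕ) = (a : ℕ) + 2 * s
      · rw [if_pos ⟨ha, by omega⟩, if_pos hb, if_pos ha]
      · rw [if_neg (fun h => hb (by omega)), if_neg hb]
    · rw [if_neg (fun h => ha h.1)]; split_ifs <;> rfl
  rw [e] at hE
  have h := sum_mul_sq_eq_zero W hW s _ c hE hY
  rw [Finset.sum_eq_single ⟨i, by omega⟩] at h
  · simpa [dif_pos hi] using h
  · intro a _ ha
    have : ¬ ((a : ℕ) = i) := fun e => ha (Fin.ext e)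
    simp [this]
  · intro hh; exact absurd (Finset.mem_univ _) hh

/-! ## (T1) the window vector -/

/-- Collapsing a Kronecker sum over `Fin n`. -/
theorem sum_ite_eq_val (f : Fin n → ℂ) (m : ℕ) :
    (∑ k : Fin n, if (k : ℕ) = m then f k else 0) = if hm : m < n then f ⟨m, hm⟩ else 0 := by
  by_cases hm : m < n
  · rw [dif_pos hm, Finset.sum_eq_single ⟨m, hm⟩]
    · rw [if_pos rfl]
    · intro k _ hk
      rw [if_neg (fun e => hk (Fin.ext e))]
    · intro hh; exact absurd (Finset.mem_univ _) hh
  · rw [dif_neg hm]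
    exact Finset.sum_eq_zero fun k _ => if_neg (fun e => hm (by have := k.isLt; omega))

/-- The indicator of the window `[i, i+s)` is a sum of `s` Kroneckers. -/
theorem ite_window_eq_sum (s i k : ℕ) :
    (if i ≤ k ∧ k < i + s then (1 : ℂ) else 0) = ∑ a ∈ Finset.range s, if k = i + a then (1 : ℂ) else 0 := by
  by_cases h : i ≤ k ∧ k < i + s
  · rw [if_pos h, Finset.sum_eq_single (k - i)]
    · rw [if_pos (by omega)]
    · intro a _ ha; rw [if_neg (by omega)]
    · intro hh; rw [Finset.mem_range] at hh; exact absurd (by omega) hh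
  · rw [if_neg h]
    symm
    exact Finset.sum_eq_zero fun a ha => by rw [Finset.mem_range] at ha; exact if_neg (by omega)

/-- **(T1) the window identity.**  For `J, L_s(c), U_1(p)` in a nilpotent space: `Σ_k p_k · C_k(c) = 0`, where
`C_k(c) = Σ_{i ≤ k < i+s, i+s<n} c_i` is the window sum (the mixed identity `Σ_{a<s} tr(L_s(c) J^a U_1(p) J^{s−1−a}) = 0`).
[memo §1 (T1); this seat (uniform in `n`, `s`)] -/
theorem window_orth (W : Submodule ℂ (Matrix (Fin n) (Fin n) ℂ)) (hW : ∀ A ∈ W, IsNilpotent A) (s : ℕ)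
    (c p : Fin n → ℂ)
    (hJ : (Matrix.of fun a b : Fin n => if (b : ℕ) = (a : ℕ) + 1 then (1 : ℂ) else 0) ∈ W)
    (hY : (Matrix.of fun a b : Fin n => if (a : ℕ) = (b : ℕ) + s then c b else 0) ∈ W)
    (hZ : (Matrix.of fun a b : Fin n => if (b : ℕ) = (a : ℕ) + 1 then p a else 0) ∈ W) :
    ∑ k : Fin n, p k * (∑ i : Fin n, if (i : ℕ) ≤ (k : ℕ) ∧ (k : ℕ) < (i : ℕ) + s ∧ (i : ℕ) + s < n then c i else 0) = 0 := by
  have hmix := trace_mixed_eq_zero_of_mem W hW (A := Matrix.of fun a b : Fin n => if (b : ℕ) = (a : ℕ) + 1 then (1 : ℂ) else 0)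
    (E := Matrix.of fun a b : Fin n => if (b : ℕ) = (a : ℕ) + 1 then p a else 0)
    (X := Matrix.of fun a b : Fin n => if (a : ℕ) = (b : ℕ) + s then c b else 0) hJ hZ hY s
  -- each term: `tr(L_s(c) · J^a U_1(p) J^{s-1-a}) = Σ_i c_i p_{i+a}`
  have term : ∀ a : ℕ, ∀ ha : a < s, Matrix.trace ((Matrix.of fun a b : Fin n => if (a : ℕ) = (b : ℕ) + s then c b else 0) *
      ((Matrix.of fun a b : Fin n => if (b : ℕ) = (a : ℕ) + 1 then (1 : ℂ) else 0) ^ a *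
        (Matrix.of fun a b : Fin n => if (b : ℕ) = (a : ℕ) + 1 then p a else 0) *
        (Matrix.of fun a b : Fin n => if (b : ℕ) = (a : ℕ) + 1 then (1 : ℂ) else 0) ^ (s - 1 - a))) =
      ∑ i : Fin n, if hi : (i : ℕ) + s < n then p ⟨(i : ℕ) + a, by omega⟩ * c i else 0 := by
    intro a ha
    rw [shiftPow_eq_upperBand, shiftPow_eq_upperBand, upperBand_mul_upperBand, upperBand_mul_upperBand]
    have e : a + 1 + (s - 1 - a) = s := by omega
    simp only [e, one_mul, mul_one]
    rw [trace_lowerBand_mul_upperBand]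
    refine Finset.sum_congr rfl fun i _ => ?_
    by_cases hi : (i : ℕ) + s < n
    · rw [if_pos hi, dif_pos hi, dif_pos (by omega), dif_pos (by omega)]
    · rw [if_neg hi, dif_neg hi]
  have hmix' : ∑ a ∈ Finset.range s, ∑ i : Fin n,
      (if hi : (i : ℕ) + s < n then (if ha : a < s then p ⟨(i : ℕ) + a, by omega⟩ * c i else 0) else 0) = 0 := by
    have e2 : (∑ a ∈ Finset.range s, ∑ i : Fin n,
        (if hi : (i : ℕ) + s < n then (if ha : a < s then p ⟨(i : ℕ) + a, by omega⟩ * c i else 0) else 0)) =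
        ∑ a ∈ Finset.range s, Matrix.trace ((Matrix.of fun a b : Fin n => if (a : ℕ) = (b : ℕ) + s then c b else 0) *
          ((Matrix.of fun a b : Fin n => if (b : ℕ) = (a : ℕ) + 1 then (1 : ℂ) else 0) ^ a *
            (Matrix.of fun a b : Fin n => if (b : ℕ) = (a : ℕ) + 1 then p a else 0) *
            (Matrix.of fun a b : Fin n => if (b : ℕ) = (a : ℕ) + 1 then (1 : ℂ) else 0) ^ (s - 1 - a))) := by
      refine Finset.sum_congr rfl fun a ha => ?_
      rw [Finset.mem_range] at ha
      rw [term a ha]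
      refine Finset.sum_congr rfl fun i _ => ?_
      by_cases hi : (i : ℕ) + s < n
      · rw [dif_pos hi, dif_pos hi, dif_pos ha]
      · rw [dif_neg hi, dif_neg hi]
    rw [e2]; exact hmix
  -- reindex `k = i + a`
  rw [Finset.sum_comm] at hmix'
  have e : (∑ i : Fin n, ∑ a ∈ Finset.range s,
        (if hi : (i : ℕ) + s < n then (if ha : a < s then p ⟨(i : ℕ) + a, by omega⟩ * c i else 0) else 0)) =
      ∑ k : Fin n, p k * ∑ i : Fin n, (if (i : ℕ) ≤ (k : ℕ) ∧ (k : ℕ) < (i : ℕ) + s ∧ (i : ℕ) + s < n then c i else 0) := by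
    calc ∑ i : Fin n, ∑ a ∈ Finset.range s,
          (if hi : (i : ℕ) + s < n then (if ha : a < s then p ⟨(i : ℕ) + a, by omega⟩ * c i else 0) else 0)
        = ∑ i : Fin n, ∑ a ∈ Finset.range s, ∑ k : Fin n,
            (if (k : ℕ) = (i : ℕ) + a then (if (i : ℕ) + s < n then p k * c i else 0) else 0) := by
          refine Finset.sum_congr rfl fun i _ => Finset.sum_congr rfl fun a ha => ?_
          rw [Finset.mem_range] at ha
          rw [sum_ite_eq_val (fun k => if (i : ℕ) + s < n then p k * c i else 0) ((i : ℕ) + a)]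
          by_cases hi : (i : ℕ) + s < n
          · rw [dif_pos hi, dif_pos ha, dif_pos (by omega), if_pos hi]
          · rw [dif_neg hi]; split_ifs <;> rfl
      _ = ∑ i : Fin n, ∑ k : Fin n, ∑ a ∈ Finset.range s,
            (if (k : ℕ) = (i : ℕ) + a then (if (i : ℕ) + s < n then p k * c i else 0) else 0) := by
          refine Finset.sum_congr rfl fun i _ => Finset.sum_comm
      _ = ∑ i : Fin n, ∑ k : Fin n, p k * (if (i : ℕ) ≤ (k : ℕ) ∧ (k : ℕ) < (i : ℕ) + s ∧ (i : ℕ) + s < n then c i else 0) := by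
          refine Finset.sum_congr rfl fun i _ => Finset.sum_congr rfl fun k _ => ?_
          by_cases hi : (i : ℕ) + s < n
          · have hL : (∑ a ∈ Finset.range s, (if (k : ℕ) = (i : ℕ) + a then (if (i : ℕ) + s < n then p k * c i else 0) else 0)) =
                (if (i : ℕ) ≤ (k : ℕ) ∧ (k : ℕ) < (i : ℕ) + s then (1 : ℂ) else 0) * (p k * c i) := by
              rw [ite_window_eq_sum, Finset.sum_mul]
              refine Finset.sum_congr rfl fun a _ => ?_
              rw [if_pos hi]; split_ifs <;> simp
            rw [hL]
            by_cases hk : (i : ℕ) ≤ (k : ℕ) ∧ (k : ℕ) < (i : ℕ) + s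
            · rw [if_pos hk, if_pos ⟨hk.1, hk.2, hi⟩, one_mul]
            · rw [if_neg hk, if_neg (fun h => hk ⟨h.1, h.2.1⟩), zero_mul, mul_zero]
          · have h0 : ∀ a : ℕ, (if (k : ℕ) = (i : ℕ) + a then (if (i : ℕ) + s < n then p k * c i else 0) else 0) = 0 :=
              fun a => by rw [if_neg hi]; split_ifs <;> rfl
            simp only [h0, Finset.sum_const_zero]
            rw [if_neg (fun h => hi h.2.2), mul_zero]
      _ = ∑ k : Fin n, p k * ∑ i : Fin n, (if (i : ℕ) ≤ (k : ℕ) ∧ (k : ℕ) < (i : ℕ) + s ∧ (i : ℕ) + s < n then c i else 0) := by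
          rw [Finset.sum_comm]
          refine Finset.sum_congr rfl fun k _ => ?_
          rw [Finset.mul_sum]
  rw [← e]; exact hmix'

/-- ★ **(T1) membership of the window vector.**  In the frame of ✓ `…ThmCnGradedCount` (`P_1 = W.map dp1`, `N_1 = W.map dm1`, zero slack at
height `1`: `dim P_1 + dim N_1 = n − 1`), if `J ∈ W` and `L_s(c) ∈ W` then the lower band of the window vector is a member:
`L_1(C(c)) = Σ_k C_k(c) E_{k+1,k} ∈ W`. [memo §1 (T1) «C(c) ∈ L_1»; this seat] -/
theorem window_lower_mem (W : Submodule ℂ (Matrix (Fin n) (Fin n) ℂ)) (hW : ∀ A ∈ W, IsNilpotent A)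
    (hgr : ∀ A ∈ W, ∀ d : ℤ, (Matrix.of fun a b : Fin n => if (b : ℤ) - (a : ℤ) = d then A a b else 0) ∈ W)
    (dp1 dm1 : Matrix (Fin n) (Fin n) ℂ →ₗ[ℂ] (Fin (n - 1) → ℂ))
    (hdp1 : ∀ A (i : Fin (n - 1)) (a b : Fin n), (a : ℕ) = i → (b : ℕ) = i + 1 → dp1 A i = A a b)
    (hdm1 : ∀ A (i : Fin (n - 1)) (a b : Fin n), (a : ℕ) = i + 1 → (b : ℕ) = i → dm1 A i = A a b)
    (hPN1 : ∀ q ∈ W.map dm1, ∀ p ∈ W.map dp1, q ⬝ᵥ p = 0)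
    (gsum1 : Module.finrank ℂ (W.map dp1) + Module.finrank ℂ (W.map dm1) = n - 1)
    (hJ : (Matrix.of fun a b : Fin n => if (b : ℕ) = (a : ℕ) + 1 then (1 : ℂ) else 0) ∈ W)
    (s : ℕ) (c : Fin n → ℂ)
    (hY : (Matrix.of fun a b : Fin n => if (a : ℕ) = (b : ℕ) + s then c b else 0) ∈ W) :
    (Matrix.of fun a b : Fin n => if (a : ℕ) = (b : ℕ) + 1 then
      (fun k : Fin n => ∑ i : Fin n, if (i : ℕ) ≤ (k : ℕ) ∧ (k : ℕ) < (i : ℕ) + s ∧ (i : ℕ) + s < n then c i else 0) b else 0) ∈ W := by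
  classical
  set C : Fin n → ℂ := fun k => ∑ i : Fin n, if (i : ℕ) ≤ (k : ℕ) ∧ (k : ℕ) < (i : ℕ) + s ∧ (i : ℕ) + s < n then c i else 0 with hC
  -- the window vector is orthogonal to `P_1`
  have hortho : ∀ v ∈ W.map dp1, (fun k : Fin (n - 1) => C ⟨(k : ℕ), by omega⟩) ⬝ᵥ v = 0 := by
    rintro _ ⟨A, hA, rfl⟩
    obtain ⟨p, hp⟩ : ∃ p : Fin n → ℂ, ∀ a : Fin n, p a = if ha : (a : ℕ) + 1 < n then dp1 A ⟨(a : ℕ), by omega⟩ else 0 :=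
      ⟨_, fun _ => rfl⟩
    have hZ : (Matrix.of fun a b : Fin n => if (b : ℕ) = (a : ℕ) + 1 then p a else 0) ∈ W :=
      upper_band_mem W hgr 1 dp1 hdp1 A hA p (fun i => by rw [hp, dif_pos (by dsimp only; omega)])
    have h := window_orth W hW s c p hJ hY hZ
    rw [dotProduct]
    have h2 : ∑ k : Fin n, p k * C k = ∑ k : Fin n, (if hk : (k : ℕ) + 1 < n then dp1 A ⟨(k : ℕ), by omega⟩ * C ⟨(k : ℕ), by omega⟩ else 0) := by
      refine Finset.sum_congr rfl fun k _ => ?_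
      rw [hp]
      by_cases hk : (k : ℕ) + 1 < n
      · rw [dif_pos hk, dif_pos hk]
      · rw [dif_neg hk, dif_neg hk, zero_mul]
    rw [h2, sum_dite_eq_sum_fin 1 (fun k hk => dp1 A ⟨(k : ℕ), by omega⟩ * C ⟨(k : ℕ), by omega⟩)] at h
    rw [← h]
    refine Finset.sum_congr rfl fun k _ => ?_
    rw [mul_comm]
  obtain ⟨B, hB, hBe⟩ := mem_of_dot_eq_zero (W.map dp1) (W.map dm1) hPN1 gsum1 _ hortho
  exact lower_band_mem W hgr 1 dm1 hdm1 B hB C (fun i => by rw [hBe])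

/-! ## (T2) the mixed word -/

/-- **(T2) the mixed word.**  `U_{s+1}(x), L_s(c), L_1(C)` in a nilpotent space ⇒ `Σ_i x_i (c_{i+1} C_i + C_{i+s} c_i) [i+s+1<n] = 0`
(`tr(X (L_s L_1 + L_1 L_s)) = 0`, ✓ `trace_mixed_eq_zero_of_mem` with `m = 2`). [memo §1 (T2); this seat] -/
theorem mixed_word (W : Submodule ℂ (Matrix (Fin n) (Fin n) ℂ)) (hW : ∀ A ∈ W, IsNilpotent A) (s : ℕ) (x c C : Fin n → ℂ)
    (hX : (Matrix.of fun a b : Fin n => if (b : ℕ) = (a : ℕ) + (s + 1) then x a else 0) ∈ W)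
    (hY : (Matrix.of fun a b : Fin n => if (a : ℕ) = (b : ℕ) + s then c b else 0) ∈ W)
    (hY1 : (Matrix.of fun a b : Fin n => if (a : ℕ) = (b : ℕ) + 1 then C b else 0) ∈ W) :
    ∑ i : Fin n, (if hi : (i : ℕ) + (s + 1) < n then
      x i * (c ⟨(i : ℕ) + 1, by omega⟩ * C i + C ⟨(i : ℕ) + s, by omega⟩ * c i) else 0) = 0 := by
  have hmix := trace_mixed_eq_zero_of_mem W hW hY hY1 hX 2
  simp only [Finset.sum_range_succ, Finset.sum_range_zero, zero_add, show 2 - 1 - 0 = 1 from rfl, show 2 - 1 - 1 = 0 from rfl,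
    pow_zero, pow_one, Matrix.one_mul, Matrix.mul_one] at hmix
  rw [lowerBand_mul_lowerBand, lowerBand_mul_lowerBand, show 1 + s = s + 1 from add_comm 1 s, trace_upperBand_mul_lowerBand,
    trace_upperBand_mul_lowerBand, ← Finset.sum_add_distrib] at hmix
  have e : (∑ i : Fin n, (if hi : (i : ℕ) + (s + 1) < n then
      x i * (c ⟨(i : ℕ) + 1, by omega⟩ * C i + C ⟨(i : ℕ) + s, by omega⟩ * c i) else 0)) =
      ∑ i : Fin n, ((if (i : ℕ) + (s + 1) < n then x i * (if hb : (i : ℕ) + s < n then C ⟨(i : ℕ) + s, hb⟩ * c i else 0) else 0) +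
        (if (i : ℕ) + (s + 1) < n then x i * (if hb : (i : ℕ) + 1 < n then c ⟨(i : ℕ) + 1, hb⟩ * C i else 0) else 0)) := by
    refine Finset.sum_congr rfl fun i _ => ?_
    by_cases hi : (i : ℕ) + (s + 1) < n
    · rw [dif_pos hi, if_pos hi, if_pos hi, dif_pos (by omega), dif_pos (by omega)]; ring
    · rw [dif_neg hi, if_neg hi, if_neg hi, add_zero]
  rw [e]; exact hmix

end Summit.ValiantsHypothesis.ValiantsHypothesis.Theorems.GrenetZeon.HeavyTopThmCIdentities

end
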